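import Summits.HubbardSuperconductivity.HubbardSuperconductivity.Statement
import Literature.MathematicalPhysics.QuantumLattice.PairFieldEvenSideLRO
import Literature.MathematicalPhysics.QuantumLattice.HubbardEnergyDensityVariationalPrinciple
import HarnessLib

/-!
# Finite-volume characterisation of `HubbardSuperconductivity`

The summit `HubbardSuperconductivity` (`d_{x²-y²}` pair-field long-range order of EVERY sequence of
normalised sector ground states of the pure repulsive 2D Hubbard torus, `liminf` over the even sides)
is stated in the thermodynamic-limit format `HasLongRangeOrder`. This file proves, sorry-free, that it
is EQUIVALENT to a purely finite-volume, uniform statement: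

> there are `U > 0`, `δ ∈ (0, 1/2)`, `c > 0` and `L₀` such that for every even side `L ≥ L₀` and every
> unit ground state `φ` of `hubbardTorus 2 L 1 U` in the sector `(2⌊(1-δ)L²/2⌋, S^z = 0)`,
> `c · L⁴ ≤ re ⟨φ, (√2 Δ_d)† (√2 Δ_d) φ⟩`.

* `hubbardSuperconductivity_of_uniform_dWave_bound` — the uniform bound implies the summit (bookkeeping
  through `hasLongRangeOrder_even_of_le`);
* `uniform_dWave_bound_of_hubbardSuperconductivity` — the converse: a near-infimum selection of ground
  states (sector ground states exist at every side, `exists_unit_isGroundStateInSector_rectN`) is an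
  admissible sequence, its `liminf` is positive, and positivity transfers to the infimum over the whole
  ground-state manifold, uniformly in the side;
* `hubbardSuperconductivity_iff_uniform_dWave_bound` — the equivalence.

Consequence for any attack: the summit asks for nothing less (and nothing more) than a volume-order
lower bound on a four-fermion ground-state expectation, uniform over the whole ground eigenspace of the
sector — statements about pressures, Gibbs states or susceptibilities do not by themselves suffice.

References: D. J. Scalapino, Phys. Rep. 250 (1995) 329, §2 eq. (2.4) (pair-field order functional);
S. Friedli, Y. Velenik, *Statistical Mechanics of Lattice Systems* (CUP 2017), §3.7.2 Def. 3.27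
(long-range order as a `liminf`). The equivalence itself is elementary (folklore).
-/

noncomputable section

namespace Summit.HubbardSuperconductivity.HubbardSuperconductivity.Theorems

open Matrix Filter Literature.Probability.LatticeModels Literature.MathematicalPhysics.QuantumLattice
open scoped ComplexOrder Topology

/-- The `d`-wave order functional `re ⟨φ, (√2Δ_d)†(√2Δ_d) φ⟩` of a torus state is non-negative. [folklore] -/
theorem re_expect_pairField_nonneg (g : Site 2 → ℝ) (n : ℕ)
    (φ : Fock (Orb (FermionTorus 2 (n + 1)))) :
    0 ≤ (expect ((pairField g (n + 1))ᴴ * pairField g (n + 1)) φ).re := by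
  have h := (pairField_conjTranspose_mul_self_posSemidef g (n + 1)).re_dotProduct_nonneg φ
  simpa [Literature.MathematicalPhysics.QuantumLattice.expect] using h

/-- **Uniform finite-volume bound ⇒ summit.** If for some `U > 0`, `δ ∈ (0, 1/2)`, `c > 0`, `L₀`,
every unit sector ground state `φ` at every even side `n + 1 ≥ L₀` has
`c (n+1)⁴ ≤ re ⟨φ, (√2Δ_d)†(√2Δ_d) φ⟩`, then `HubbardSuperconductivity` holds. [folklore] -/
theorem hubbardSuperconductivity_of_uniform_dWave_bound
    (h : ∃ U : ℝ, 0 < U ∧ ∃ δ ∈ Set.Ioo (0 : ℝ) (1 / 2), ∃ c : ℝ, 0 < c ∧ ∃ L₀ : ℕ,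
      ∀ n : ℕ, Even (n + 1) → L₀ ≤ n + 1 →
        ∀ φ : Fock (Orb (FermionTorus 2 (n + 1))), star φ ⬝ᵥ φ = 1 →
          IsGroundStateInSector (hubbardTorus 2 (n + 1) 1 U)
              (2 * ⌊(1 - δ) * ((n + 1 : ℕ) : ℝ) ^ 2 / 2⌋₊) 0 φ →
            c * ((n + 1 : ℕ) : ℝ) ^ 4 ≤
              (expect ((pairField dWaveFormFactor (n + 1))ᴴ * pairField dWaveFormFactor (n + 1)) φ).re) :
    HubbardSuperconductivity := by
  obtain ⟨U, hU, δ, hδ, c, hc, L₀, hb⟩ := h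
  refine ⟨U, hU, δ, hδ, fun N ψ hyp => ?_⟩
  refine hasLongRangeOrder_even_of_le dWaveFormFactor ψ (fun n hn => (hyp (n + 1) hn).2.1) hc L₀ ?_
  intro n hn hL
  rw [sum_pairFieldCorr_succ]
  obtain ⟨hN, hnorm, hgs⟩ := hyp (n + 1) hn
  rw [hN] at hgs
  exact hb n hn hL (ψ (n + 1)) hnorm hgs

/-- **Summit ⇒ uniform finite-volume bound.** If `HubbardSuperconductivity` holds with parameters
`U, δ`, then for some `c > 0` and `L₀`, EVERY unit sector ground state `φ` at EVERY even side
`n + 1 ≥ L₀` satisfies `c (n+1)⁴ ≤ re ⟨φ, (√2Δ_d)†(√2Δ_d) φ⟩`. Proof: select at each side a ground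
state within `1` of the infimum of the order functional; this is an admissible sequence, so its `liminf`
is positive, and the infimum inherits a volume-order lower bound. [folklore] -/
theorem uniform_dWave_bound_of_hubbardSuperconductivity (h : HubbardSuperconductivity) :
    ∃ U : ℝ, 0 < U ∧ ∃ δ ∈ Set.Ioo (0 : ℝ) (1 / 2), ∃ c : ℝ, 0 < c ∧ ∃ L₀ : ℕ,
      ∀ n : ℕ, Even (n + 1) → L₀ ≤ n + 1 →
        ∀ φ : Fock (Orb (FermionTorus 2 (n + 1))), star φ ⬝ᵥ φ = 1 →
          IsGroundStateInSector (hubbardTorus 2 (n + 1) 1 U)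
              (2 * ⌊(1 - δ) * ((n + 1 : ℕ) : ℝ) ^ 2 / 2⌋₊) 0 φ →
            c * ((n + 1 : ℕ) : ℝ) ^ 4 ≤
              (expect ((pairField dWaveFormFactor (n + 1))ᴴ * pairField dWaveFormFactor (n + 1)) φ).re := by
  obtain ⟨U, hU, δ, hδ, hS⟩ := h
  refine ⟨U, hU, δ, hδ, ?_⟩
  -- admissible states at side `L`
  set A : (L : ℕ) → Set (Fock (Orb (FermionTorus 2 L))) := fun L =>
    {φ | star φ ⬝ᵥ φ = 1 ∧
      IsGroundStateInSector (hubbardTorus 2 L 1 U) (2 * ⌊(1 - δ) * (L : ℝ) ^ 2 / 2⌋₊) 0 φ} with hA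
  have hAne : ∀ L, (A L).Nonempty := by
    intro L
    obtain ⟨φ, h1, hgs⟩ :=
      InfVolFermionState.exists_unit_isGroundStateInSector_rectN (1 : ℝ) U (n := 1 - δ)
        (by linarith [hδ.1]) L
    exact ⟨φ, h1, by simpa [ThermodynamicLimit.rectN] using hgs⟩
  -- the order functional at side `n + 1`
  set S : (n : ℕ) → Fock (Orb (FermionTorus 2 (n + 1))) → ℝ := fun n φ =>
    (expect ((pairField dWaveFormFactor (n + 1))ᴴ * pairField dWaveFormFactor (n + 1)) φ).re with hSdef
  have hS0 : ∀ n φ, 0 ≤ S n φ := fun n φ => re_expect_pairField_nonneg dWaveFormFactor n φ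
  -- its values on admissible states, infimum `s n`
  set T : ℕ → Set ℝ := fun n => S n '' A (n + 1) with hT
  have hTne : ∀ n, (T n).Nonempty := fun n => (hAne (n + 1)).image _
  have hTbdd : ∀ n, BddBelow (T n) := by
    intro n
    refine ⟨0, ?_⟩
    rintro t ⟨φ, -, rfl⟩
    exact hS0 n φ
  -- near-infimum selection
  have hsel : ∀ n, ∃ φ ∈ A (n + 1), S n φ < sInf (T n) + 1 := by
    intro n
    obtain ⟨t, ht, hlt⟩ := exists_lt_of_csInf_lt (hTne n) (lt_add_one (sInf (T n)))
    obtain ⟨φ, hφ, rfl⟩ := ht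
    exact ⟨φ, hφ, hlt⟩
  choose φsel hφselA hφsel using hsel
  obtain ⟨φ₀, hφ₀⟩ := hAne 0
  -- the admissible sequence
  let ψ : (L : ℕ) → Fock (Orb (FermionTorus 2 L)) := fun L =>
    match L with
    | 0 => φ₀
    | n + 1 => φsel n
  have hψadm : ∀ L, Even L → (fun L : ℕ => 2 * ⌊(1 - δ) * (L : ℝ) ^ 2 / 2⌋₊) L =
      2 * ⌊(1 - δ) * (L : ℝ) ^ 2 / 2⌋₊ ∧ star (ψ L) ⬝ᵥ ψ L = 1 ∧
      IsGroundStateInSector (hubbardTorus 2 L 1 U) ((fun L : ℕ => 2 * ⌊(1 - δ) * (L : ℝ) ^ 2 / 2⌋₊) L)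
        0 (ψ L) := by
    intro L _
    cases L with
    | zero => exact ⟨rfl, hφ₀.1, hφ₀.2⟩
    | succ n => exact ⟨rfl, (hφselA n).1, (hφselA n).2⟩
  have hLRO := hS (fun L : ℕ => 2 * ⌊(1 - δ) * (L : ℝ) ^ 2 / 2⌋₊) ψ hψadm
  -- unfold the long-range order
  set u : ℕ → ℝ := fun L => (∑ x ∈ halfOpenBox 2 L, ∑ y ∈ halfOpenBox 2 L,
      torusPullback (pairFieldCorr dWaveFormFactor ψ) L x y) / ((halfOpenBox 2 L).card : ℝ) ^ 2 with hu
  change 0 < liminf (fun k : ℕ => u (2 * k)) atTop at hLRO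
  -- value of `u` at a positive side
  have hu_succ : ∀ n, u (n + 1) = S n (φsel n) / ((n + 1 : ℕ) : ℝ) ^ 4 := by
    intro n
    simp only [hu]
    rw [sum_torusPullback_succ, sum_pairFieldCorr_succ]
  have hu0 : ∀ k, 0 ≤ u (2 * k) := by
    intro k
    cases k with
    | zero =>
      have h0 : ((halfOpenBox 2 (2 * 0)).card : ℝ) ^ 2 = 0 := by rw [card_halfOpenBox]; simp
      simp only [hu]
      rw [h0, div_zero]
    | succ k =>
      rw [show 2 * (k + 1) = (2 * k + 1) + 1 by ring, hu_succ]
      exact div_nonneg (hS0 _ _) (by positivity)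
  set ℓ := liminf (fun k : ℕ => u (2 * k)) atTop with hℓ
  have hev : ∀ᶠ k : ℕ in atTop, ℓ / 2 < u (2 * k) :=
    eventually_lt_of_lt_liminf (by rw [hℓ]; linarith) (isBoundedUnder_of ⟨0, fun k => hu0 k⟩)
  obtain ⟨K, hK⟩ := eventually_atTop.1 hev
  -- Archimedes: `(ℓ/4) (n+1)⁴ ≥ 1` for large `n`
  obtain ⟨M, hM⟩ := exists_nat_ge (4 / ℓ)
  refine ⟨ℓ / 4, by positivity, max (2 * K) (max M 1), ?_⟩
  intro n hn hL φ hφ1 hφgs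
  obtain ⟨k, hk⟩ := hn
  have hk' : 2 * k = n + 1 := by omega
  have hKk : K ≤ k := by
    have := le_of_max_le_left hL
    omega
  have hMn : (M : ℝ) ≤ ((n + 1 : ℕ) : ℝ) := by
    have := le_of_max_le_left (le_of_max_le_right hL)
    exact_mod_cast this
  have h1n : (1 : ℝ) ≤ ((n + 1 : ℕ) : ℝ) := by
    have := le_of_max_le_right (le_of_max_le_right hL)
    exact_mod_cast this
  -- the selected state at side `n + 1` beats `ℓ/2 · (n+1)⁴`
  have hsel_gt : ℓ / 2 * ((n + 1 : ℕ) : ℝ) ^ 4 < S n (φsel n) := by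
    have h := hK k hKk
    rw [hk', hu_succ, lt_div_iff₀ (by positivity)] at h
    exact h
  -- hence so does the infimum, up to `1`
  have hinf : ℓ / 2 * ((n + 1 : ℕ) : ℝ) ^ 4 - 1 < sInf (T n) := by
    have := hφsel n
    linarith
  -- and every admissible state is above the infimum
  have hφT : S n φ ∈ T n := ⟨φ, ⟨hφ1, hφgs⟩, rfl⟩
  have hφinf : sInf (T n) ≤ S n φ := csInf_le (hTbdd n) hφT
  -- `(ℓ/4)(n+1)⁴ ≥ 1`
  have hℓpos : 0 < ℓ := hLRO
  have hpow : ((n + 1 : ℕ) : ℝ) ≤ ((n + 1 : ℕ) : ℝ) ^ 4 := by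
    calc ((n + 1 : ℕ) : ℝ) = ((n + 1 : ℕ) : ℝ) ^ 1 := (pow_one _).symm
      _ ≤ ((n + 1 : ℕ) : ℝ) ^ 4 := pow_le_pow_right₀ h1n (by norm_num)
  have hone : 1 ≤ ℓ / 4 * ((n + 1 : ℕ) : ℝ) ^ 4 := by
    have h4 : 4 / ℓ ≤ ((n + 1 : ℕ) : ℝ) ^ 4 := hM.trans (hMn.trans hpow)
    rw [div_le_iff₀ hℓpos] at h4
    linarith
  change ℓ / 4 * ((n + 1 : ℕ) : ℝ) ^ 4 ≤ S n φ
  linarith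

/-- **Finite-volume characterisation of the summit.** `HubbardSuperconductivity` holds if and only if
for some `U > 0`, `δ ∈ (0, 1/2)`, `c > 0` and `L₀`, every unit ground state `φ` of
`hubbardTorus 2 L 1 U` in the sector `(2⌊(1-δ)L²/2⌋, S^z = 0)` at every even side `L = n + 1 ≥ L₀`
obeys the volume-order bound `c L⁴ ≤ re ⟨φ, (√2Δ_d)†(√2Δ_d) φ⟩` on the `d_{x²-y²}` pair field.
[folklore] -/
theorem hubbardSuperconductivity_iff_uniform_dWave_bound :
    HubbardSuperconductivity ↔
      ∃ U : ℝ, 0 < U ∧ ∃ δ ∈ Set.Ioo (0 : ℝ) (1 / 2), ∃ c : ℝ, 0 < c ∧ ∃ L₀ : ℕ,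
        ∀ n : ℕ, Even (n + 1) → L₀ ≤ n + 1 →
          ∀ φ : Fock (Orb (FermionTorus 2 (n + 1))), star φ ⬝ᵥ φ = 1 →
            IsGroundStateInSector (hubbardTorus 2 (n + 1) 1 U)
                (2 * ⌊(1 - δ) * ((n + 1 : ℕ) : ℝ) ^ 2 / 2⌋₊) 0 φ →
              c * ((n + 1 : ℕ) : ℝ) ^ 4 ≤
                (expect ((pairField dWaveFormFactor (n + 1))ᴴ * pairField dWaveFormFactor (n + 1))
                  φ).re :=
  ⟨uniform_dWave_bound_of_hubbardSuperconductivity, hubbardSuperconductivity_of_uniform_dWave_bound⟩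

end Summit.HubbardSuperconductivity.HubbardSuperconductivity.Theorems

end
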